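import Summits.Schanuel.Schanuel.Theorems.ZilberEacCylinderCriterion
import Summits.Schanuel.Schanuel.Theorems.ZilberEacParamSurfaceTransport
import Summits.Schanuel.Schanuel.Theorems.ZilberEacFibreCycleNewton
import HarnessLib

/-!
# Arbitrary base branches, CVI: CURVES OVER `ℚ̄` WITH AN ASYMPTOTIC LINE OF RATIONAL SLOPE —
# `GL₂(ℤ)`-transport of the complete verdict; every surface over the hyperbola `x₁² − x₀² = 1`

HONEST FRAMING.  Cell `pub-schanuel` (Zilber's Exponential-Algebraic Closedness, case ladder;
host summit Schanuel), seat 2, gen 33.  Mantova–Masser's case and the density of exponential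
points are invariant under the monomial changes `(x, y) ↦ (U x, y^U)`, `U ∈ GL₂(ℤ)`
(`unprojectedDense_of_mmCase_of_base_transport`, gen 21).  A branch of the base curve asymptotic
to a LINE `p x₁ − q x₀ → c` of rational slope becomes, after an `SL₂(ℤ)` change taking `(q, p)`
to `(1, 0)`, a branch with a HORIZONTAL asymptote, where the complete verdict of file CIV applies.
**`unprojectedDense_of_mmCase_of_transport_topRowRoot`** packages this (the transformed curve
`G` with the hypotheses of file CIV and the relation `G(x) = 0 ↔ F(Vx) = 0`); example: EVERY
surface of the case over the hyperbola `x₁² − x₀² = 1` is dense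
(**`unprojectedDense_of_mmCase_hyperbola_all`**: `x₁' = x₁ − x₀ → 0`,
`G = x₁'² + 2x₀x₁' − 1`).  What this is NOT: branches with rational direction but unbounded offset
(parabolic, e.g. `x₁² = x₀³ + 1` has direction `∞` with `x₀ → ∞`), curves with only irrational
real directions beyond the growth dichotomy, transcendental coefficients, Fib(3,2), EC(3,2) — OPEN;
the question OPEN in general; NOT Schanuel's conjecture (neither used nor implied); EAC ⇏ SC.
-/

noncomputable section

open Filter Topology Set Complex Polynomial
open Literature.NumberTheory.Transcendental Literature.ModelTheory.Zilber
open Literature.ModelTheory.ExponentialFields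

set_option linter.dupNamespace false

namespace Summit.Schanuel.Schanuel.Theorems

section RationalAsymptote

variable (F : ℂ[X][X])

/-- **`GL₂(ℤ)`-transport of the complete verdict.**  `U V = V U = 1`; `G` the transformed curve
polynomial (`G(x) = 0 ↔ F(V x) = 0`) satisfying the hypotheses of file CIV (irreducible over `ℚ̄`
of degree `≥ 2` with a root of its top row, transpose irreducible over `ℚ̄`); then every surface
of Mantova–Masser's case with base curve `{F = 0}` is dense. [cite: MantovaMasser2023, §1 Further
remarks, p. 5 (the question, open in general)] (new) -/
theorem unprojectedDense_of_mmCase_of_transport_topRowRoot {U V : Matrix (Fin 2) (Fin 2) ℤ}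
    (hUV : U * V = 1) (hVU : V * U = 1) (G : ℂ[X][X])
    (hFG : ∀ x : Fin 2 → ℂ, (G.map (Polynomial.evalRingHom (x 0))).eval (x 1) = 0 ↔
      (F.map (Polynomial.evalRingHom (intLinMap V x 0))).eval (intLinMap V x 1) = 0)
    (hGirr : Irreducible G) (hn : 2 ≤ G.natDegree) (N : ℕ) (hN : ∀ j, (G.coeff j).natDegree ≤ N)
    (T : ℂ[X]) (hT : ∀ j, T.coeff j = (G.coeff j).coeff N) (hT0 : T ≠ 0) {θ : ℂ} (hTθ : T.IsRoot θ)
    (Gt : ℂ[X][X]) (hGt : ∀ x y : ℂ, (Gt.map (Polynomial.evalRingHom x)).eval y =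
      (G.map (Polynomial.evalRingHom y)).eval x)
    (hGtirr : Irreducible Gt) (halgt : ∀ i j, IsAlgebraic ℚ ((Gt.coeff j).coeff i))
    (G₃ : MvPolynomial (Fin 3) ℂ)
    (hG₃ : ∀ v : Fin 3 → ℂ, MvPolynomial.eval v G₃ = (G.map (Polynomial.evalRingHom (v 0))).eval (v 1))
    {W : Set (Fin 2 ⊕ Fin 2 → ℂ)} (hmm : MMCaseDimPiOneFree W)
    (hbase : MvPolynomial.zeroLocus ℂ (MvPolynomial.vanishingIdeal ℂ (projAdd '' (W ∩ torusLocus ℂ 2))) =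
      {x : Fin 2 → ℂ | (F.map (Polynomial.evalRingHom (x 0))).eval (x 1) = 0}) :
    UnprojectedDense W := by
  classical
  refine unprojectedDense_of_mmCase_of_base_transport hUV hVU _ (fun W' hmm' hbase' => ?_) hmm hbase
  have himg : intLinMap U '' {x : Fin 2 → ℂ | (F.map (Polynomial.evalRingHom (x 0))).eval (x 1) = 0} =
      {x : Fin 2 → ℂ | (G.map (Polynomial.evalRingHom (x 0))).eval (x 1) = 0} := by
    ext x
    simp only [Set.mem_image, Set.mem_setOf_eq]
    constructor
    · rintro ⟨y, hy, rfl⟩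
      rw [hFG, intLinMap_intLinMap_of_mul_eq_one hVU]
      exact hy
    · intro hx
      exact ⟨intLinMap V x, (hFG x).1 hx, intLinMap_intLinMap_of_mul_eq_one hUV x⟩
  rw [himg] at hbase'
  exact unprojectedDense_of_mmCase_topRowRoot_algebraic G hGirr hn N hN T hT hT0 hTθ Gt hGt hGtirr
    halgt G₃ hG₃ hmm' hbase'

/-! ## Example: the hyperbola `x₁² − x₀² = 1` -/

/-- `4X² + 4` is not a square in `ℂ[X]` (it vanishes at `±i` to order one). [folklore] -/
theorem four_X_sq_add_four_ne_sq (s : ℂ[X]) : (2 * X : ℂ[X]) ^ 2 - 4 * 1 * (-1) ≠ s ^ 2 := by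
  intro hs
  have hev : ∀ z : ℂ, (Polynomial.eval z s) ^ 2 = 4 * z ^ 2 + 4 := by
    intro z
    have h := congrArg (Polynomial.eval z) hs
    simp only [Polynomial.eval_sub, Polynomial.eval_pow, Polynomial.eval_mul, Polynomial.eval_X,
      Polynomial.eval_ofNat, Polynomial.eval_one, Polynomial.eval_neg] at h
    rw [← h]; ring
  have hI : Polynomial.eval Complex.I s = 0 := by
    have h := hev Complex.I
    rw [Complex.I_sq] at h
    exact pow_eq_zero_iff (n := 2) (by norm_num) |>.1 (by rw [h]; ring)
  have hnI : Polynomial.eval (-Complex.I) s = 0 := by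
    have h := hev (-Complex.I)
    rw [neg_sq, Complex.I_sq] at h
    exact pow_eq_zero_iff (n := 2) (by norm_num) |>.1 (by rw [h]; ring)
  -- `s` has the two roots `±i` but degree `≤ 1`
  have hs0 : s ≠ 0 := by
    intro h0
    have h := hev 0
    rw [h0, Polynomial.eval_zero] at h
    norm_num at h
  have hdeg4 : ((2 * X : ℂ[X]) ^ 2 - 4 * 1 * (-1)).natDegree = 2 := by
    rw [show (2 * X : ℂ[X]) ^ 2 - 4 * 1 * (-1) = Polynomial.C 4 * X ^ 2 + Polynomial.C 4 by
      simp only [map_ofNat]; ring]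
    compute_degree!
  have hsdeg : s.natDegree = 1 := by
    have h := congrArg Polynomial.natDegree hs
    rw [hdeg4, Polynomial.natDegree_pow] at h
    omega
  obtain ⟨α, β, hsf⟩ : ∃ α β : ℂ, s = Polynomial.C α * X + Polynomial.C β :=
    ⟨s.coeff 1, s.coeff 0, Polynomial.eq_X_add_C_of_natDegree_le_one hsdeg.le⟩
  rw [hsf] at hI hnI hsdeg
  simp only [Polynomial.eval_add, Polynomial.eval_mul, Polynomial.eval_C, Polynomial.eval_X] at hI hnI
  have hβ : β = 0 := by linear_combination (hI + hnI) / 2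
  have hα : α = 0 := by
    have h : α * Complex.I = 0 := by rw [hβ, add_zero] at hI; exact hI
    exact (mul_eq_zero.1 h).resolve_right Complex.I_ne_zero
  rw [hα, hβ, map_zero, zero_mul, zero_add, Polynomial.natDegree_zero] at hsdeg
  exact zero_ne_one hsdeg

/-- **Every surface of Mantova–Masser's case over the hyperbola `x₁² − x₀² = 1` is dense**
(`U = (1 0; -1 1)`: `x₁' = x₁ − x₀ → 0` along the branch asymptotic to `x₁ = x₀`; the transformed
curve `x₁'² + 2x₀x₁' − 1 = 0` has the horizontal asymptote `x₁' → 0`).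
[cite: MantovaMasser2023, §1 Further remarks, p. 5 (the question, open in general)] (new) -/
theorem unprojectedDense_of_mmCase_hyperbola_all {W : Set (Fin 2 ⊕ Fin 2 → ℂ)}
    (hmm : MMCaseDimPiOneFree W)
    (hbase : MvPolynomial.zeroLocus ℂ (MvPolynomial.vanishingIdeal ℂ (projAdd '' (W ∩ torusLocus ℂ 2))) =
      {x : Fin 2 → ℂ | x 1 ^ 2 - x 0 ^ 2 - 1 = 0}) :
    UnprojectedDense W := by
  classical
  set Fh : ℂ[X][X] := X ^ 2 - Polynomial.C (X ^ 2 : ℂ[X]) - 1 with hFh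
  have hFhev : ∀ a b : ℂ, (Fh.map (Polynomial.evalRingHom a)).eval b = b ^ 2 - a ^ 2 - 1 := by
    intro a b; simp [hFh]
  -- the transformed curve `G = x₁'² + 2x₀ x₁' − 1`
  set G : ℂ[X][X] := Polynomial.C (1 : ℂ[X]) * X ^ 2 + Polynomial.C (2 * X : ℂ[X]) * X +
    Polynomial.C (-1 : ℂ[X]) with hG
  have hGev : ∀ a b : ℂ, (G.map (Polynomial.evalRingHom a)).eval b = b ^ 2 + 2 * a * b - 1 := by
    intro a b; simp [hG]; ring
  have hGirr : Irreducible G :=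
    irreducible_quadratic_of_disc_ne_sq one_ne_zero (isCoprime_one_left) four_X_sq_add_four_ne_sq
  have hGnat : G.natDegree = 2 := by rw [hG]; exact Polynomial.natDegree_quadratic one_ne_zero
  have hGcoeff : ∀ j, G.coeff j = if j = 2 then 1 else if j = 1 then 2 * X else if j = 0 then -1 else 0 := by
    intro j
    rw [hG]
    simp only [Polynomial.coeff_add, Polynomial.coeff_C_mul, Polynomial.coeff_X_pow, Polynomial.coeff_X,
      Polynomial.coeff_C]
    rcases j with _ | _ | _ | j <;> simp
  -- the transpose `Gt = 2x·y + (x² − 1)` (in `y` over `ℂ[x]`)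
  set Gt : ℂ[X][X] := Polynomial.C (2 * X : ℂ[X]) * X + Polynomial.C (X ^ 2 - 1 : ℂ[X]) with hGt
  have hGtev : ∀ x y : ℂ, (Gt.map (Polynomial.evalRingHom x)).eval y = 2 * x * y + (x ^ 2 - 1) := by
    intro x y; simp [hGt]
  have ht0 : Gt.coeff 0 = X ^ 2 - 1 := by
    rw [hGt, Polynomial.coeff_add, Polynomial.coeff_C_mul, Polynomial.coeff_X_zero, mul_zero, zero_add,
      Polynomial.coeff_C_zero]
  have ht1 : Gt.coeff 1 = 2 * X := by
    rw [hGt, Polynomial.coeff_add, Polynomial.coeff_C_mul, Polynomial.coeff_X_one, mul_one,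
      Polynomial.coeff_C, if_neg one_ne_zero, add_zero]
  have htj : ∀ j, 2 ≤ j → Gt.coeff j = 0 := by
    intro j hj
    rw [hGt, Polynomial.coeff_add, Polynomial.coeff_C_mul, Polynomial.coeff_X, Polynomial.coeff_C,
      if_neg (by omega), if_neg (by omega), mul_zero, add_zero]
  have hX20 : (2 * X : ℂ[X]) ≠ 0 := mul_ne_zero (by norm_num) Polynomial.X_ne_zero
  have hGtdeg : Gt.degree = 1 := by
    rw [hGt]; compute_degree!
  have hGtirr : Irreducible Gt := by
    refine Polynomial.irreducible_of_degree_eq_one_of_isRelPrime_coeff hGtdeg ?_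
    rw [ht0, ht1]
    exact (show IsCoprime (X ^ 2 - 1 : ℂ[X]) (2 * X) from
      ⟨-1, Polynomial.C (1 / 2 : ℂ) * X, by
        have h2 : (2 * X : ℂ[X]) = Polynomial.C 2 * X := by simp [map_ofNat]
        have hC : Polynomial.C (1 / 2 : ℂ) * Polynomial.C 2 = 1 := by
          rw [← Polynomial.C_mul]; norm_num
        rw [h2]
        linear_combination (X ^ 2 : ℂ[X]) * hC⟩).isRelPrime
  have halgt : ∀ i j, IsAlgebraic ℚ ((Gt.coeff j).coeff i) := by
    intro i j
    have hcases : (Gt.coeff j).coeff i = 0 ∨ (Gt.coeff j).coeff i = 1 ∨ (Gt.coeff j).coeff i = -1 ∨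
        (Gt.coeff j).coeff i = 2 := by
      rcases j with _ | _ | j
      · rw [ht0, Polynomial.coeff_sub, Polynomial.coeff_X_pow, Polynomial.coeff_one]
        rcases i with _ | _ | _ | i <;> simp
      · rw [ht1]
        rw [show (2 * X : ℂ[X]) = Polynomial.C 2 * X by simp [map_ofNat], Polynomial.coeff_C_mul,
          Polynomial.coeff_X]
        split_ifs <;> simp
      · rw [htj (j + 2) (by omega), Polynomial.coeff_zero]; simp
    rcases hcases with h | h | h | h <;> rw [h]
    · exact isAlgebraic_zero
    · exact isAlgebraic_one
    · exact isAlgebraic_one.neg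
    · simpa using isAlgebraic_algebraMap (R := ℚ) (A := ℂ) 2
  -- the matrices
  set U : Matrix (Fin 2) (Fin 2) ℤ := !![1, 0; -1, 1] with hU
  set V : Matrix (Fin 2) (Fin 2) ℤ := !![1, 0; 1, 1] with hV
  have hUV : U * V = 1 := by rw [hU, hV]; decide
  have hVU : V * U = 1 := by rw [hU, hV]; decide
  have hVx : ∀ x : Fin 2 → ℂ, intLinMap V x 0 = x 0 ∧ intLinMap V x 1 = x 0 + x 1 := by
    intro x
    simp [intLinMap, hV, Fin.sum_univ_two]
  have hG₃ev : ∀ v : Fin 3 → ℂ, MvPolynomial.eval v (MvPolynomial.X 1 ^ 2 +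
      2 * MvPolynomial.X 0 * MvPolynomial.X 1 - 1 : MvPolynomial (Fin 3) ℂ) =
      (G.map (Polynomial.evalRingHom (v 0))).eval (v 1) := by
    intro v; rw [hGev]; simp
  refine unprojectedDense_of_mmCase_of_transport_topRowRoot Fh hUV hVU G (fun x => ?_) hGirr
    (by rw [hGnat]) 1 (fun j => ?_) (Polynomial.C 2 * X) (fun j => ?_)
    (mul_ne_zero (by simp) Polynomial.X_ne_zero) (θ := 0) (by simp) Gt
    (fun x y => by rw [hGtev, hGev]; ring) hGtirr halgt _ hG₃ev hmm
    (by rw [hbase]; ext x; simp only [Set.mem_setOf_eq, hFhev])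
  · rw [hGev, (hVx x).1, (hVx x).2, hFhev]
    constructor <;> intro h <;> linear_combination h
  · rw [hGcoeff]
    split_ifs
    · simp
    · rw [show (2 * X : ℂ[X]) = Polynomial.C 2 * X by simp [map_ofNat]]; compute_degree!
    · simp
    · simp
  · rw [hGcoeff, Polynomial.coeff_C_mul, Polynomial.coeff_X]
    rcases j with _ | _ | _ | j
    · simp [Polynomial.coeff_one]
    · simp [show (2 * X : ℂ[X]) = Polynomial.C 2 * X by simp [map_ofNat]]
    · simp [Polynomial.coeff_one]
    · simp

end RationalAsymptote

end Summit.Schanuel.Schanuel.Theorems
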